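import Literature.Analysis.Complex.LeeYangConeDomination
import HarnessLib

/-!
# Lee–Yang zeros in an imaginary cone NEAR THE ORIGIN dominate an even entire function (local form)

Topic `Literature/Analysis/Complex` (sequel of `LeeYangConeDomination.lean`, whose global-cone theorem
`norm_le_exp_sq_of_even_of_zeros_in_cone` asks the cone condition of EVERY zero).

**Theorem** (`norm_le_exp_sq_of_even_of_zeros_in_cone_near`). Let `f : ℂ → ℂ` be entire and even,
of order `< 2` (`‖f z‖ ≤ C exp(‖z‖^σ)`, `σ < 2`), `f 0 ≠ 0`, and assume

* (cone near `0`) every zero `z` of `f` with `‖z‖ ≤ r₀` satisfies `(1 + κ)(Re z)² ≤ (1 - κ)(Im z)²`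
  (`0 < κ`, `0 < r₀`);
* (the real axis dominates) `‖f (x + iy)‖ ≤ ‖f x‖` for all real `x, y`;
* (exponential growth on the real axis) `‖f x‖ ≤ ‖f 0‖ exp(A |x|)` for real `x` (`0 ≤ A`).

Then for every real `s`, with `T := ½ Re(f''(0)/f(0))` and the far-zero constant
`Φ := 7A / (r₀ log 2)`,

  `‖f s‖ ≤ ‖f 0‖ · exp( s² · ( (T + Φ)/κ + Φ ) )`.

For the complex-sourced partition function `Z(h) = tr e^{-β(H - hQ)}` of a finite quantum system the
last two hypotheses are AUTOMATIC (Petz's `|tr e^{A+iB}| ≤ tr e^A`, and `Z(s) ≤ Z(0) e^{β‖Q‖|s|}`), so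
the theorem converts "zero-freeness of `Z` on the double sector `(1+κ)(Re h)² > (1-κ)(Im h)²` of the
disc `|h| ≤ r₀`" plus the LINEAR response `T = β²[(Q,Q) - ⟨Q⟩²]/2` into a bound on the full non-linear
response for all real sources (`ComplexSourcePartitionFn.lean`).

## Proof

As in the global theorem, `f(z) = g(z²)` with `g` entire of order `< 1`, normalised to
`G = g/g(0)`; the tree's genus-zero Hadamard machinery (`HadamardGenusZero.hadamard_core`) gives
`G(w) = ∏ᵢ (1 - w/uᵢ)` over the zeros `uᵢ` of `G` counted with multiplicity, `Σ 1/|uᵢ| < ∞`.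
Near zeros (`|uᵢ| ≤ r₀²`, i.e. `|zᵢ| ≤ r₀`) are in the cone and contribute `≤ exp(s²(-Re uᵢ⁻¹)/κ)`;
far zeros contribute `≤ exp(s²/|uᵢ|)`. The far sum `Σ_{|uᵢ| > r₀²} 1/|uᵢ|` is bounded by dyadic
shells and **Jensen's inequality** (`HadamardGenusZero.count_le_of_bound`,
`HadamardGenusZero.wsum_two_mul_le`): on `|w| = R`, `‖G w‖ ≤ e^{A√R}` by the two real-axis
hypotheses, so `n_G(r) ≤ A√(2r)/log 2` and `Σ_far 1/|uᵢ| ≤ (2+√2)·2A/(r₀ log 2) ≤ 7A/(r₀ log 2)`;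
finally `Σ_near (-Re uᵢ⁻¹) ≤ Σ_all (-Re uᵢ⁻¹) + Σ_far 1/|uᵢ|` and `Σ_all (-Re uᵢ⁻¹) = ½ Re(f''(0)/f(0))`
(`hasDerivAt_hadamardProduct_zero'`, `f'' (0) = 2 g'(0)`).

## References

* C. M. Newman, Comm. Math. Phys. 41 (1975) 1, Thm. 3; T. D. Lee, C. N. Yang, Phys. Rev. 87 (1952) 410.
* J. B. Conway, *Functions of One Complex Variable I* (1978), Ch. XI §3 (Jensen, Hadamard).
-/

noncomputable section

open Filter Set Finset
open _root_.Complex _root_.Topology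

namespace Literature.Analysis.Complex

open HadamardGenusZero

/-! ### Generic-index version of the derivative of a canonical product at the origin -/

/-- `(∏ᵢ (1 - bᵢ w))'(0) = -Σᵢ bᵢ` for a summable family over any index type (cf. the `ℕ`-indexed
`hasDerivAt_hadamardProduct_zero`). [cite: Conway1978, Ch. XI] [folklore] -/
theorem hasDerivAt_hadamardProduct_zero' {ι : Type*} {b : ι → ℂ} (hb : Summable fun n => ‖b n‖)
    {G : ℂ → ℂ} (hG : ∀ w : ℂ, HasProd (fun n => 1 - b n * w) (G w)) :
    HasDerivAt G (-∑' n, b n) 0 := by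
  classical
  set B : ℝ := ∑' n, ‖b n‖ with hB
  have hB0 : 0 ≤ B := tsum_nonneg fun n => norm_nonneg _
  have hbs : Summable b := hb.of_norm
  have hrem : ∀ w : ℂ, ‖G w - 1 - (-(∑' n, b n) * w)‖ ≤
      Real.exp (‖w‖ * B) - 1 - ‖w‖ * B := by
    intro w
    set a : ι → ℂ := fun n => -(b n * w) with ha
    have has : HasSum a (-(∑' n, b n) * w) := by
      have h1 : HasSum (fun n => b n * w) ((∑' n, b n) * w) := hbs.hasSum.mul_right w
      simpa [ha, neg_mul] using h1.neg
    have hprod : Tendsto (fun t : Finset ι => ∏ n ∈ t, (1 + a n)) atTop (𝓝 (G w)) := by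
      have h := hG w
      simp only [HasProd, SummationFilter.unconditional_filter] at h
      refine h.congr' (Eventually.of_forall fun t => Finset.prod_congr rfl fun n _ => ?_)
      simp [ha, sub_eq_add_neg]
    have hsum : Tendsto (fun t : Finset ι => ∑ n ∈ t, a n) atTop (𝓝 (-(∑' n, b n) * w)) := by
      have h := has
      simp only [HasSum, SummationFilter.unconditional_filter] at h
      exact h
    have hlim : Tendsto (fun t : Finset ι => ‖∏ n ∈ t, (1 + a n) - 1 - ∑ n ∈ t, a n‖) atTop
        (𝓝 ‖G w - 1 - (-(∑' n, b n) * w)‖) :=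
      ((hprod.sub tendsto_const_nhds).sub hsum).norm
    refine le_of_tendsto' hlim fun t => ?_
    refine (norm_prod_one_add_sub_one_sub_sum_le t a).trans ?_
    have hna : ∀ n, ‖a n‖ = ‖w‖ * ‖b n‖ := fun n => by simp [ha, mul_comm]
    have hle : ∑ n ∈ t, ‖a n‖ ≤ ‖w‖ * B := by
      simp_rw [hna, ← Finset.mul_sum]
      exact mul_le_mul_of_nonneg_left
        (hb.sum_le_tsum t fun n _ => norm_nonneg _) (norm_nonneg _)
    have h0 : 0 ≤ ∑ n ∈ t, ‖a n‖ := Finset.sum_nonneg fun n _ => norm_nonneg _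
    set x := ∑ n ∈ t, ‖a n‖
    set y := ‖w‖ * B
    have hmv : y - x ≤ Real.exp y - Real.exp x := by
      have h1 : Real.exp x * (y - x) + Real.exp x ≤ Real.exp y := by
        have := Real.add_one_le_exp (y - x)
        have h2 : Real.exp y = Real.exp x * Real.exp (y - x) := by
          rw [← Real.exp_add]; ring_nf
        rw [h2]; nlinarith [Real.exp_pos x]
      nlinarith [Real.add_one_le_exp x, h0]
    linarith
  have hG0 : G 0 = 1 := by
    have h := hG 0
    simp only [mul_zero, sub_zero] at h
    exact h.unique hasProd_one
  rw [hasDerivAt_iff_isLittleO, Asymptotics.isLittleO_iff]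
  intro ε hε
  have hball : ∀ᶠ w in 𝓝 (0 : ℂ), ‖w‖ * (B + 1) ≤ 1 ∧ ‖w‖ * (B ^ 2 + 1) ≤ ε := by
    have h1 : ∀ᶠ w in 𝓝 (0 : ℂ), ‖w‖ ≤ min (1 / (B + 1)) (ε / (B ^ 2 + 1)) := by
      have hpos : 0 < min (1 / (B + 1)) (ε / (B ^ 2 + 1)) := by positivity
      rw [Metric.eventually_nhds_iff]
      exact ⟨_, hpos, fun w hw => by simpa [dist_zero_right] using hw.le⟩
    filter_upwards [h1] with w hw
    constructor
    · have := (le_min_iff.1 hw).1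
      rwa [le_div_iff₀ (by positivity)] at this
    · have := (le_min_iff.1 hw).2
      rwa [le_div_iff₀ (by positivity)] at this
  filter_upwards [hball] with w hw
  rw [hG0, sub_zero, smul_eq_mul, mul_comm (w : ℂ)]
  have hwB1 : ‖w‖ * B ≤ 1 := by nlinarith [norm_nonneg w, hw.1]
  have hwB0 : 0 ≤ ‖w‖ * B := mul_nonneg (norm_nonneg _) hB0
  calc ‖G w - 1 - -(∑' n, b n) * w‖ ≤ Real.exp (‖w‖ * B) - 1 - ‖w‖ * B := hrem w
    _ ≤ (‖w‖ * B) ^ 2 := by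
        have h := Real.abs_exp_sub_one_sub_id_le (x := ‖w‖ * B)
          (by rw [abs_of_nonneg hwB0]; exact hwB1)
        exact le_trans (le_abs_self _) h
    _ = (‖w‖ * B ^ 2) * ‖w‖ := by ring
    _ ≤ ε * ‖w‖ := by
        refine mul_le_mul_of_nonneg_right ?_ (norm_nonneg _)
        nlinarith [hw.2, norm_nonneg w, sq_nonneg B]

/-! ### Jensen counting for a function of exponential type `A√|w|` -/

/-- If `G` is entire, `G 0 = 1` and `‖G w‖ ≤ exp(A √‖w‖)`, then the number of zeros in `|w| ≤ r`
(with multiplicity) is at most `A √(2r) / log 2`. [cite: Conway1978, Ch. XI §3] [folklore] -/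
theorem count_le_of_exp_sqrt {G : ℂ → ℂ} (hG : Differentiable ℂ G) (hG1 : G 0 = 1) {A : ℝ}
    (hA : 0 ≤ A) (hb : ∀ w : ℂ, ‖G w‖ ≤ Real.exp (A * Real.sqrt ‖w‖)) {r : ℝ} (hr : 0 < r) :
    (count hG (by rw [hG1]; exact one_ne_zero) r : ℝ) ≤ A * Real.sqrt (2 * r) / Real.log 2 := by
  have h0 : G 0 ≠ 0 := by rw [hG1]; exact one_ne_zero
  have hM : (1 : ℝ) ≤ Real.exp (A * Real.sqrt (2 * r)) := Real.one_le_exp (by positivity)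
  have h := count_le_of_bound hG h0 hr hM (fun z hz => by rw [← hz]; exact hb z)
  rwa [hG1, norm_one, div_one, Real.log_exp] at h

/-- Dyadic iteration of `HadamardGenusZero.wsum_two_mul_le`:
`W(2^K ρ) ≤ W(ρ) + Σ_{k<K} n(2^{k+1}ρ)/(2^k ρ)`. [folklore] -/
theorem wsum_two_pow_mul_le {G : ℂ → ℂ} (hG : Differentiable ℂ G) (h0 : G 0 ≠ 0) {ρ : ℝ}
    (hρ : 0 < ρ) (K : ℕ) :
    wsum hG h0 (2 ^ K * ρ) ≤ wsum hG h0 ρ +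
      ∑ k ∈ Finset.range K, (count hG h0 (2 ^ (k + 1) * ρ) : ℝ) / (2 ^ k * ρ) := by
  induction K with
  | zero => simp
  | succ K ih =>
    rw [Finset.sum_range_succ]
    have h := wsum_two_mul_le hG h0 (R := 2 ^ K * ρ) (by positivity)
    rw [show (2 : ℝ) ^ (K + 1) * ρ = 2 * (2 ^ K * ρ) by ring]
    linarith

/-- **The far-zero sum.** Under the hypotheses of `count_le_of_exp_sqrt`, for every `0 < r₀` and
every `R`, `W(R) - W(r₀²) ≤ 7A/(r₀ log 2)`, where `W(R) = Σ_{|u| ≤ R} m(u)/|u|`. [folklore] -/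
theorem wsum_sub_wsum_le {G : ℂ → ℂ} (hG : Differentiable ℂ G) (hG1 : G 0 = 1) {A : ℝ}
    (hA : 0 ≤ A) (hb : ∀ w : ℂ, ‖G w‖ ≤ Real.exp (A * Real.sqrt ‖w‖)) {r₀ : ℝ} (hr₀ : 0 < r₀)
    (R : ℝ) :
    wsum hG (by rw [hG1]; exact one_ne_zero) R - wsum hG (by rw [hG1]; exact one_ne_zero) (r₀ ^ 2) ≤
      7 * A / (r₀ * Real.log 2) := by
  have h0 : G 0 ≠ 0 := by rw [hG1]; exact one_ne_zero
  set ρ : ℝ := r₀ ^ 2 with hρ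
  have hρ0 : 0 < ρ := by positivity
  have hlog2 : 0 < Real.log 2 := Real.log_pos (by norm_num)
  -- each dyadic term: `n(2^{k+1}ρ)/(2^k ρ) ≤ (2A/(r₀ log 2)) (1/√2)^k`
  set q : ℝ := 1 / Real.sqrt 2 with hq
  have hsqrt2 : 0 < Real.sqrt 2 := Real.sqrt_pos.2 (by norm_num)
  have hq0 : 0 ≤ q := by positivity
  have hq1 : q < 1 := by
    rw [hq, div_lt_one hsqrt2]
    have : Real.sqrt 1 < Real.sqrt 2 := Real.sqrt_lt_sqrt (by norm_num) (by norm_num)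
    simpa using this
  have hterm : ∀ k : ℕ, (count hG h0 (2 ^ (k + 1) * ρ) : ℝ) / (2 ^ k * ρ) ≤
      2 * A / (r₀ * Real.log 2) * q ^ k := by
    intro k
    have hc := count_le_of_exp_sqrt hG hG1 hA hb (r := 2 ^ (k + 1) * ρ) (by positivity)
    have hsq : Real.sqrt (2 * (2 ^ (k + 1) * ρ)) = 2 * r₀ * Real.sqrt 2 ^ k := by
      rw [show 2 * (2 ^ (k + 1) * ρ) = (2 * r₀) ^ 2 * 2 ^ k by rw [hρ]; ring,
        Real.sqrt_mul (by positivity), Real.sqrt_sq (by positivity)]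
      congr 1
      rw [show (2 : ℝ) ^ k = (Real.sqrt 2 ^ 2) ^ k by rw [Real.sq_sqrt (by norm_num : (0:ℝ) ≤ 2)],
        ← pow_mul, show 2 * k = k * 2 by ring, pow_mul, Real.sqrt_sq (by positivity)]
    rw [hsq] at hc
    have h2k : (0 : ℝ) < 2 ^ k * ρ := by positivity
    calc (count hG h0 (2 ^ (k + 1) * ρ) : ℝ) / (2 ^ k * ρ)
        ≤ A * (2 * r₀ * Real.sqrt 2 ^ k) / Real.log 2 / (2 ^ k * ρ) :=
          div_le_div_of_nonneg_right hc h2k.le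
      _ = 2 * A / (r₀ * Real.log 2) * (Real.sqrt 2 ^ k / 2 ^ k) := by
          rw [hρ]; field_simp
      _ = 2 * A / (r₀ * Real.log 2) * q ^ k := by
          congr 1
          rw [hq, div_pow, one_pow]
          have h2 : (2 : ℝ) ^ k = Real.sqrt 2 ^ k * Real.sqrt 2 ^ k := by
            rw [← mul_pow, Real.mul_self_sqrt (by norm_num : (0:ℝ) ≤ 2)]
          rw [h2]
          field_simp
  -- sum the geometric series: `Σ_{k<K} q^k ≤ 1/(1-q) ≤ 2 + √2 ≤ 7/2`
  have hgeom : ∀ K : ℕ, ∑ k ∈ Finset.range K, q ^ k ≤ 7 / 2 := by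
    intro K
    have h1 := geom_sum_Ico_le_of_lt_one hq0 hq1 (m := 0) (n := K)
    rw [← Finset.range_eq_Ico, pow_zero] at h1
    refine h1.trans ?_
    -- `1/(1-q) ≤ 7/2` iff `2 ≤ 7 (1 - q)` iff `7q ≤ 5` iff `7 ≤ 5 √2`
    have hs : (7 : ℝ) / 5 ≤ Real.sqrt 2 := by
      rw [show (7 : ℝ) / 5 = Real.sqrt ((7 / 5) ^ 2) by rw [Real.sqrt_sq (by norm_num)]]
      exact Real.sqrt_le_sqrt (by norm_num)
    have hq' : q ≤ 5 / 7 := by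
      rw [hq, div_le_div_iff₀ hsqrt2 (by norm_num)]
      linarith
    rw [div_le_div_iff₀ (by linarith) (by norm_num)]
    linarith
  have hdy : ∀ K : ℕ, wsum hG h0 (2 ^ K * ρ) ≤ wsum hG h0 ρ + 7 * A / (r₀ * Real.log 2) := by
    intro K
    refine (wsum_two_pow_mul_le hG h0 hρ0 K).trans ?_
    have hs : ∑ k ∈ Finset.range K, (count hG h0 (2 ^ (k + 1) * ρ) : ℝ) / (2 ^ k * ρ) ≤
        2 * A / (r₀ * Real.log 2) * (7 / 2) := by
      calc ∑ k ∈ Finset.range K, (count hG h0 (2 ^ (k + 1) * ρ) : ℝ) / (2 ^ k * ρ)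
          ≤ ∑ k ∈ Finset.range K, 2 * A / (r₀ * Real.log 2) * q ^ k := Finset.sum_le_sum fun k _ => hterm k
        _ = 2 * A / (r₀ * Real.log 2) * ∑ k ∈ Finset.range K, q ^ k := (Finset.mul_sum _ _ _).symm
        _ ≤ 2 * A / (r₀ * Real.log 2) * (7 / 2) :=
            mul_le_mul_of_nonneg_left (hgeom K) (by positivity)
    have : 2 * A / (r₀ * Real.log 2) * (7 / 2) = 7 * A / (r₀ * Real.log 2) := by ring
    linarith
  -- any `R` lies below some `2^K ρ`
  obtain ⟨K, hK⟩ : ∃ K : ℕ, R ≤ 2 ^ K * ρ := by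
    obtain ⟨K, hK⟩ := pow_unbounded_of_one_lt (R / ρ) (by norm_num : (1 : ℝ) < 2)
    exact ⟨K, by rw [div_lt_iff₀ hρ0] at hK; exact hK.le⟩
  have hmono := wsum_mono hG h0 hK
  linarith [hdy K]

/-! ### The local domination theorem -/

/-- **Zeros in an imaginary cone near the origin dominate an even entire function by its curvature
at the origin (Lee–Yang ⇒ GHS/Newman-type bound, local form).** See the module docstring:
`‖f s‖ ≤ ‖f 0‖ exp( s² ((T + Φ)/κ + Φ) )`, `T = ½ Re(f''(0)/f(0))`, `Φ = 7A/(r₀ log 2)`.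
[cite: Newman1975, Thm. 3] [cite: Conway1978, Ch. XI Thm. 3.4] -/
theorem norm_le_exp_sq_of_even_of_zeros_in_cone_near {f : ℂ → ℂ} (hf : Differentiable ℂ f)
    {C σ : ℝ} (hσ : σ < 2) (hgr : ∀ z, ‖f z‖ ≤ C * Real.exp (‖z‖ ^ σ))
    (heven : ∀ z, f (-z) = f z) (h0 : f 0 ≠ 0) {κ r₀ A : ℝ} (hκ : 0 < κ) (hr₀ : 0 < r₀) (hA : 0 ≤ A)
    (hcone : ∀ z, f z = 0 → ‖z‖ ≤ r₀ → (1 + κ) * z.re ^ 2 ≤ (1 - κ) * z.im ^ 2)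
    (hdom : ∀ x y : ℝ, ‖f ((x : ℂ) + (y : ℂ) * Complex.I)‖ ≤ ‖f x‖)
    (hlip : ∀ x : ℝ, ‖f x‖ ≤ ‖f 0‖ * Real.exp (A * |x|)) (s : ℝ) :
    ‖f s‖ ≤ ‖f 0‖ * Real.exp (s ^ 2 *
      (((1 / 2) * (iteratedDeriv 2 f 0 / f 0).re + 7 * A / (r₀ * Real.log 2)) / κ +
        7 * A / (r₀ * Real.log 2))) := by
  -- Step 1: the normalised square-root lift `G = g / g 0`
  obtain ⟨g, hg, hgsq, hgdef⟩ := exists_differentiable_comp_sq hf heven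
  have hg0 : g 0 = f 0 := by simpa using hgsq 0
  have hg0' : g 0 ≠ 0 := hg0 ▸ h0
  set G : ℂ → ℂ := fun w => g w / g 0 with hGdef
  have hG : Differentiable ℂ G := hg.div_const (g 0)
  have hG1 : G 0 = 1 := by simp [hGdef, div_self hg0']
  have hG0 : G 0 ≠ 0 := by rw [hG1]; exact one_ne_zero
  have hf0pos : 0 < ‖f 0‖ := norm_pos_iff.2 h0
  -- growth of `G` (order `σ/2 < 1`), normalised for `hadamard_core`
  have hGgr : ∀ w, ‖G w‖ ≤ C / ‖f 0‖ * Real.exp (‖w‖ ^ (σ / 2)) := by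
    intro w
    rw [hGdef]
    simp only
    rw [norm_div, hg0, div_le_iff₀ hf0pos, hgdef]
    calc ‖f (w ^ (2⁻¹ : ℂ))‖ ≤ C * Real.exp (‖w‖ ^ (σ / 2)) := norm_apply_cpow_two_inv_le hgr w
      _ = C / ‖f 0‖ * Real.exp (‖w‖ ^ (σ / 2)) * ‖f 0‖ := by field_simp
  obtain ⟨σ', C', hσ'1, hC'1, hb'⟩ := growth_normalise hG (ρ := σ / 2) (by linarith) hGgr
  obtain ⟨hsum, hprod⟩ := hadamard_core hG hG0 hσ'1 hC'1 hb'
  -- Step 2: facts about the zero indices `i : ZIdx G` (`uᵢ = i.pt`, a zero of `G`, `uᵢ ≠ 0`)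
  have hsqrt : ∀ w : ℂ, (w ^ (2⁻¹ : ℂ)) ^ 2 = w := fun w => by
    have h := Complex.cpow_nat_inv_pow w (n := 2) two_ne_zero
    rwa [Nat.cast_ofNat] at h
  have hfz : ∀ i : ZIdx G, f ((i.pt) ^ (2⁻¹ : ℂ)) = 0 := by
    intro i
    have h1 : G i.pt = 0 := i.f_pt
    have e : G i.pt = g i.pt / g 0 := congrFun hGdef i.pt
    rw [e, div_eq_zero_iff] at h1
    rw [← hgdef]
    exact h1.resolve_right hg0'
  have hnear : ∀ i : ZIdx G, ‖i.pt‖ ≤ r₀ ^ 2 → κ * ‖(i.pt)⁻¹‖ ≤ -((i.pt)⁻¹).re := by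
    intro i hi
    set z : ℂ := (i.pt) ^ (2⁻¹ : ℂ) with hz
    have hz2 : z ^ 2 = i.pt := hsqrt _
    have hz0 : z ≠ 0 := by
      intro h; exact ZIdx.pt_ne_zero hG0 i (by rw [← hz2, h]; simp)
    have hzn : ‖z‖ ≤ r₀ := by
      have : ‖z‖ ^ 2 ≤ r₀ ^ 2 := by rw [← norm_pow, hz2]; exact hi
      exact (pow_le_pow_iff_left₀ (norm_nonneg z) hr₀.le two_ne_zero).1 this
    have h := cone_inv_sq hz0 (hcone z (hfz i) hzn)
    rwa [hz2] at h
  -- Step 3: `‖G w‖ ≤ exp(A √‖w‖)` (real axis dominates + exponential growth on the real axis)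
  have hGexp : ∀ w : ℂ, ‖G w‖ ≤ Real.exp (A * Real.sqrt ‖w‖) := by
    intro w
    rw [hGdef]
    simp only
    rw [norm_div, hg0, div_le_iff₀ hf0pos, hgdef]
    set r : ℂ := w ^ (2⁻¹ : ℂ) with hr
    have hrn : ‖r‖ = Real.sqrt ‖w‖ := by
      rw [hr, show (2⁻¹ : ℂ) = ((2⁻¹ : ℝ) : ℂ) by norm_num, Complex.norm_cpow_real,
        Real.sqrt_eq_rpow, one_div]
    have h1 : ‖f r‖ ≤ ‖f (r.re : ℂ)‖ := by
      have := hdom r.re r.im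
      rwa [Complex.re_add_im] at this
    have h2 : ‖f (r.re : ℂ)‖ ≤ ‖f 0‖ * Real.exp (A * |r.re|) := hlip r.re
    have h3 : |r.re| ≤ Real.sqrt ‖w‖ := hrn ▸ Complex.abs_re_le_norm r
    calc ‖f r‖ ≤ ‖f 0‖ * Real.exp (A * |r.re|) := h1.trans h2
      _ ≤ ‖f 0‖ * Real.exp (A * Real.sqrt ‖w‖) := by gcongr
      _ = Real.exp (A * Real.sqrt ‖w‖) * ‖f 0‖ := mul_comm _ _
  -- Step 4: the far-zero bound `W(R) - W(r₀²) ≤ Φ`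
  set Φ : ℝ := 7 * A / (r₀ * Real.log 2) with hΦ
  have hΦ0 : 0 ≤ Φ := by
    have := Real.log_pos (by norm_num : (1:ℝ) < 2); positivity
  have hfar : ∀ R, wsum hG hG0 R - wsum hG hG0 (r₀ ^ 2) ≤ Φ :=
    fun R => wsum_sub_wsum_le hG hG1 hA hGexp hr₀ R
  -- `wsum R = Σ_{i ∈ idxIn R} 1/|uᵢ|`
  have hwsum : ∀ R, ∑ i ∈ idxIn hG hG0 R, ‖i.pt‖⁻¹ = wsum hG hG0 R := by
    intro R
    rw [sum_idxIn hG hG0 R (fun u => ‖u‖⁻¹), wsum]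
    simp [div_eq_mul_inv]
  -- any finite set of FAR indices has `Σ 1/|uᵢ| ≤ Φ`
  have hfarsum : ∀ F : Finset (ZIdx G), (∀ i ∈ F, r₀ ^ 2 < ‖i.pt‖) →
      ∑ i ∈ F, ‖i.pt‖⁻¹ ≤ Φ := by
    intro F hF
    set R : ℝ := max (r₀ ^ 2) (∑ i ∈ F, ‖i.pt‖) with hR
    have hsub : F ⊆ idxIn hG hG0 R \ idxIn hG hG0 (r₀ ^ 2) := by
      intro i hi
      rw [Finset.mem_sdiff, mem_idxIn, mem_idxIn, not_le]
      exact ⟨(Finset.single_le_sum (fun j _ => norm_nonneg j.pt) hi).trans (le_max_right _ _),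
        hF i hi⟩
    calc ∑ i ∈ F, ‖i.pt‖⁻¹ ≤ ∑ i ∈ idxIn hG hG0 R \ idxIn hG hG0 (r₀ ^ 2), ‖i.pt‖⁻¹ :=
          Finset.sum_le_sum_of_subset_of_nonneg hsub fun _ _ _ => by positivity
      _ = wsum hG hG0 R - wsum hG hG0 (r₀ ^ 2) := by
          rw [← hwsum, ← hwsum, Finset.sum_sdiff_eq_sub (idxIn_mono hG hG0 (le_max_left _ _))]
      _ ≤ Φ := hfar R
  -- Step 5: the near sum `N = Σ_{|uᵢ| ≤ r₀²} (-Re uᵢ⁻¹)` and the total `Σᵢ (-Re uᵢ⁻¹) = T`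
  have hbsum : Summable fun i : ZIdx G => ‖(i.pt)⁻¹‖ := hsum.congr fun i => (norm_inv _).symm
  have hresum : Summable fun i : ZIdx G => -((i.pt)⁻¹).re := by
    refine Summable.of_norm_bounded hbsum fun i => ?_
    rw [Real.norm_eq_abs, abs_neg]
    exact Complex.abs_re_le_norm _
  have hsplit := hresum.sum_add_tsum_compl (s := idxIn hG hG0 (r₀ ^ 2))
  set N : ℝ := ∑ i ∈ idxIn hG hG0 (r₀ ^ 2), -((i.pt)⁻¹).re with hN
  set Tall : ℝ := ∑' i : ZIdx G, -((i.pt)⁻¹).re with hTall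
  -- (a) `N ≤ Tall + Φ`: the complementary (far) tsum is `≥ -Φ`
  have hN_le : N ≤ Tall + Φ := by
    have hs' : Summable fun i : ((((idxIn hG hG0 (r₀ ^ 2) : Finset (ZIdx G)) : Set (ZIdx G))ᶜ :
        Set (ZIdx G))) => -(((i : ZIdx G).pt)⁻¹).re := hresum.subtype _
    have hs'' : Summable fun i : ((((idxIn hG hG0 (r₀ ^ 2) : Finset (ZIdx G)) : Set (ZIdx G))ᶜ :
        Set (ZIdx G))) => ‖(((i : ZIdx G).pt)⁻¹)‖ := hbsum.subtype _
    have h1 : ∑' i : ((((idxIn hG hG0 (r₀ ^ 2) : Finset (ZIdx G)) : Set (ZIdx G))ᶜ : Set (ZIdx G))),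
          -‖(((i : ZIdx G).pt)⁻¹)‖ ≤
        ∑' i : ((((idxIn hG hG0 (r₀ ^ 2) : Finset (ZIdx G)) : Set (ZIdx G))ᶜ : Set (ZIdx G))),
          -(((i : ZIdx G).pt)⁻¹).re :=
      hs''.neg.tsum_le_tsum (fun i => by
        linarith [Complex.abs_re_le_norm (((i : ZIdx G).pt)⁻¹),
          le_abs_self (((i : ZIdx G).pt)⁻¹).re]) hs'
    have h2 : ∑' i : ((((idxIn hG hG0 (r₀ ^ 2) : Finset (ZIdx G)) : Set (ZIdx G))ᶜ : Set (ZIdx G))),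
        ‖(((i : ZIdx G).pt)⁻¹)‖ ≤ Φ := by
      refine hs''.tsum_le_of_sum_le fun F => ?_
      have hF := hfarsum (F.map (Function.Embedding.subtype _)) (fun i hi => by
        rw [Finset.mem_map] at hi
        obtain ⟨j, _, rfl⟩ := hi
        have hj : (j : ZIdx G) ∉ idxIn hG hG0 (r₀ ^ 2) := fun hmem =>
          (Set.notMem_of_mem_compl j.2) (Finset.mem_coe.2 hmem)
        rw [mem_idxIn, not_le] at hj
        exact hj)
      rw [Finset.sum_map] at hF
      simpa [norm_inv] using hF
    rw [tsum_neg] at h1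
    have hsplit' : N + ∑' i : ((((idxIn hG hG0 (r₀ ^ 2) : Finset (ZIdx G)) : Set (ZIdx G))ᶜ :
        Set (ZIdx G))), -(((i : ZIdx G).pt)⁻¹).re = Tall := hsplit
    linarith
  -- (b) `Tall = ½ Re(f''(0)/f(0))`
  have hTall_eq : Tall = (1 / 2) * (iteratedDeriv 2 f 0 / f 0).re := by
    have hGd : HasDerivAt G (-∑' i : ZIdx G, (i.pt)⁻¹) 0 := by
      refine hasDerivAt_hadamardProduct_zero' hbsum fun w => ?_
      have h := hprod w
      rw [hG1, div_one] at h
      have heq : (fun i : ZIdx G => 1 - (i.pt)⁻¹ * w) = fun i => 1 - w / i.pt := by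
        funext i; rw [div_eq_mul_inv, mul_comm]
      rw [heq]; exact h
    have hgd : deriv g 0 = -(∑' i : ZIdx G, (i.pt)⁻¹) * g 0 := by
      have h1 : HasDerivAt G (deriv g 0 / g 0) 0 := (hg 0).hasDerivAt.div_const (g 0)
      have h2 := h1.unique hGd
      rwa [div_eq_iff hg0'] at h2
    have hf2 : iteratedDeriv 2 f 0 = 2 * deriv g 0 := by
      have hfg : f = fun z => g (z ^ 2) := funext fun z => (hgsq z).symm
      have hd1 : ∀ z, HasDerivAt f (deriv g (z ^ 2) * (2 * z)) z := by
        intro z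
        rw [hfg]
        have h := (hg (z ^ 2)).hasDerivAt.comp z (hasDerivAt_pow 2 z)
        refine h.congr_deriv ?_
        simp [pow_one]
      have hderiv : deriv f = fun z => deriv g (z ^ 2) * (2 * z) := funext fun z => (hd1 z).deriv
      rw [iteratedDeriv_succ, iteratedDeriv_one, hderiv]
      have hdg : DifferentiableAt ℂ (deriv g) (0 ^ 2) :=
        ((hg.analyticAt _).deriv).differentiableAt
      have h3 : HasDerivAt (fun z : ℂ => deriv g (z ^ 2) * (2 * z))
          (deriv (deriv g) (0 ^ 2) * (2 * 0) * (2 * 0) + deriv g (0 ^ 2) * 2) 0 := by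
        have ha : HasDerivAt (fun z : ℂ => deriv g (z ^ 2)) (deriv (deriv g) (0 ^ 2) * (2 * 0)) 0 := by
          have h := hdg.hasDerivAt.comp (0 : ℂ) (hasDerivAt_pow 2 (0 : ℂ))
          refine h.congr_deriv ?_
          simp
        have hb' : HasDerivAt (fun z : ℂ => 2 * z) 2 0 := by
          simpa using (hasDerivAt_id (0 : ℂ)).const_mul 2
        exact ha.mul hb'
      rw [h3.deriv]
      simp
      ring
    have hre : (∑' i : ZIdx G, (i.pt)⁻¹).re = ∑' i : ZIdx G, ((i.pt)⁻¹).re :=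
      Complex.re_tsum hbsum.of_norm
    rw [hTall, tsum_neg, ← hre, hf2, hgd, hg0]
    field_simp
    simp [Complex.neg_re]
    ring
  -- Step 6: the product bound `‖f s / f 0‖ ≤ exp(s² (N/κ + Φ))`
  have hmain : ‖f s / f 0‖ ≤ Real.exp (s ^ 2 * (N / κ + Φ)) := by
    have hP : HasProd (fun i : ZIdx G => 1 - ((s : ℂ) ^ 2) / i.pt) (f s / f 0) := by
      have h := hprod ((s : ℂ) ^ 2)
      rwa [hG1, div_one, show G ((s : ℂ) ^ 2) = f s / f 0 by rw [hGdef]; simp [hgsq, hg0]] at h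
    have hPn : HasProd (fun i : ZIdx G => ‖1 - ((s : ℂ) ^ 2) / i.pt‖) ‖f s / f 0‖ :=
      hP.map normHom continuous_norm
    have ht : Tendsto (fun t : Finset (ZIdx G) => ∏ i ∈ t, ‖1 - ((s : ℂ) ^ 2) / i.pt‖) atTop
        (𝓝 ‖f s / f 0‖) := by
      simpa only [HasProd, SummationFilter.unconditional_filter] using hPn
    refine le_of_tendsto' ht fun t => ?_
    -- split `t` into near and far indices
    classical
    rw [← Finset.prod_filter_mul_prod_filter_not t (fun i => ‖i.pt‖ ≤ r₀ ^ 2)]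
    have hfactor : ∀ i : ZIdx G, 1 - ((s : ℂ) ^ 2) / i.pt = 1 - (i.pt)⁻¹ * ((s ^ 2 : ℝ) : ℂ) := by
      intro i; push_cast; rw [div_eq_mul_inv, mul_comm]
    -- near factors
    have hnearF : ∏ i ∈ t.filter (fun i => ‖i.pt‖ ≤ r₀ ^ 2), ‖1 - ((s : ℂ) ^ 2) / i.pt‖ ≤
        Real.exp (s ^ 2 * (N / κ)) := by
      calc ∏ i ∈ t.filter (fun i => ‖i.pt‖ ≤ r₀ ^ 2), ‖1 - ((s : ℂ) ^ 2) / i.pt‖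
          ≤ ∏ i ∈ t.filter (fun i => ‖i.pt‖ ≤ r₀ ^ 2), Real.exp (s ^ 2 * (-((i.pt)⁻¹).re) / κ) := by
            refine Finset.prod_le_prod (fun i _ => norm_nonneg _) fun i hi => ?_
            rw [Finset.mem_filter] at hi
            rw [hfactor]
            exact norm_one_sub_mul_le_exp_of_cone hκ (hnear i hi.2) (sq_nonneg s)
        _ = Real.exp (∑ i ∈ t.filter (fun i => ‖i.pt‖ ≤ r₀ ^ 2),
              s ^ 2 * (-((i.pt)⁻¹).re) / κ) := (Real.exp_sum _ _).symm
        _ ≤ Real.exp (s ^ 2 * (N / κ)) := by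
            refine Real.exp_le_exp.2 ?_
            have hsub : t.filter (fun i => ‖i.pt‖ ≤ r₀ ^ 2) ⊆ idxIn hG hG0 (r₀ ^ 2) := by
              intro i hi
              rw [Finset.mem_filter] at hi
              exact (mem_idxIn hG hG0).2 hi.2
            have hle : ∑ i ∈ t.filter (fun i => ‖i.pt‖ ≤ r₀ ^ 2), -((i.pt)⁻¹).re ≤ N :=
              Finset.sum_le_sum_of_subset_of_nonneg hsub fun i hi _ =>
                le_trans (by positivity) (hnear i ((mem_idxIn hG hG0).1 hi))
            have : ∑ i ∈ t.filter (fun i => ‖i.pt‖ ≤ r₀ ^ 2), s ^ 2 * (-((i.pt)⁻¹).re) / κ =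
                s ^ 2 / κ * ∑ i ∈ t.filter (fun i => ‖i.pt‖ ≤ r₀ ^ 2), -((i.pt)⁻¹).re := by
              rw [Finset.mul_sum]; refine Finset.sum_congr rfl fun i _ => ?_; ring
            rw [this, show s ^ 2 * (N / κ) = s ^ 2 / κ * N by ring]
            exact mul_le_mul_of_nonneg_left hle (by positivity)
    -- far factors
    have hfarF : ∏ i ∈ t.filter (fun i => ¬‖i.pt‖ ≤ r₀ ^ 2), ‖1 - ((s : ℂ) ^ 2) / i.pt‖ ≤
        Real.exp (s ^ 2 * Φ) := by
      calc ∏ i ∈ t.filter (fun i => ¬‖i.pt‖ ≤ r₀ ^ 2), ‖1 - ((s : ℂ) ^ 2) / i.pt‖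
          ≤ ∏ i ∈ t.filter (fun i => ¬‖i.pt‖ ≤ r₀ ^ 2), Real.exp (s ^ 2 * ‖(i.pt)⁻¹‖) := by
            refine Finset.prod_le_prod (fun i _ => norm_nonneg _) fun i _ => ?_
            calc ‖1 - ((s : ℂ) ^ 2) / i.pt‖ ≤ ‖(1 : ℂ)‖ + ‖((s : ℂ) ^ 2) / i.pt‖ := norm_sub_le _ _
              _ = 1 + s ^ 2 * ‖(i.pt)⁻¹‖ := by
                  rw [norm_one, norm_div, norm_pow, Complex.norm_real, Real.norm_eq_abs,
                    sq_abs, norm_inv, div_eq_mul_inv]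
              _ ≤ Real.exp (s ^ 2 * ‖(i.pt)⁻¹‖) := by
                  linarith [Real.add_one_le_exp (s ^ 2 * ‖(i.pt)⁻¹‖)]
        _ = Real.exp (∑ i ∈ t.filter (fun i => ¬‖i.pt‖ ≤ r₀ ^ 2), s ^ 2 * ‖(i.pt)⁻¹‖) :=
            (Real.exp_sum _ _).symm
        _ ≤ Real.exp (s ^ 2 * Φ) := by
            refine Real.exp_le_exp.2 ?_
            rw [← Finset.mul_sum]
            refine mul_le_mul_of_nonneg_left ?_ (sq_nonneg s)
            have := hfarsum (t.filter (fun i => ¬‖i.pt‖ ≤ r₀ ^ 2)) (fun i hi => by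
              rw [Finset.mem_filter, not_le] at hi; exact hi.2)
            simpa [norm_inv] using this
    have h1 : 0 ≤ ∏ i ∈ t.filter (fun i => ‖i.pt‖ ≤ r₀ ^ 2), ‖1 - ((s : ℂ) ^ 2) / i.pt‖ :=
      Finset.prod_nonneg fun i _ => norm_nonneg _
    have h2 : 0 ≤ ∏ i ∈ t.filter (fun i => ¬‖i.pt‖ ≤ r₀ ^ 2), ‖1 - ((s : ℂ) ^ 2) / i.pt‖ :=
      Finset.prod_nonneg fun i _ => norm_nonneg _
    calc _ ≤ Real.exp (s ^ 2 * (N / κ)) * Real.exp (s ^ 2 * Φ) :=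
          mul_le_mul hnearF hfarF h2 (Real.exp_pos _).le
      _ = Real.exp (s ^ 2 * (N / κ + Φ)) := by rw [← Real.exp_add]; ring_nf
  -- Step 7: conclusion
  have hfn : ‖f s‖ = ‖f 0‖ * ‖f s / f 0‖ := by
    rw [norm_div, mul_div_cancel₀ _ (norm_ne_zero_iff.2 h0)]
  rw [hfn]
  refine mul_le_mul_of_nonneg_left (hmain.trans (Real.exp_le_exp.2 ?_)) (norm_nonneg _)
  rw [← hTall_eq]
  have hs2 : 0 ≤ s ^ 2 := sq_nonneg s
  have : N / κ ≤ (Tall + Φ) / κ := div_le_div_of_nonneg_right hN_le hκ.le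
  nlinarith

end Literature.Analysis.Complex
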